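import Literature.MathematicalPhysics.QuantumFieldTheory.Balaban1983to89.B9Thm313WholeRgdFrom3152

/-!
# `Balaban1983to89.B9Thm313WholeCutLettersL2From3152` — [B9] Theorem 3.13 (p. 426): the two ORDER-ZERO block-L² letters of the re-cut schema
# `Letters313L2Pc` (`vDRDG` = D·R·D\*·G₁, `vGDRD` = G₁·D·R·D\*) ARE THEOREM 3.1's LINES FOR G′ BY (3.152) — derived from (3.46)₄ for G′, (3.42)₂,₃ for G′,
# (3.49) for P and R = ϱ(I − P)

T. Bałaban, *Propagators for lattice gauge theories in a background field*, Commun. Math. Phys. **99** (1985) 389–434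
[`Balaban1985BackgroundPropagators`, "B9"]; [4] = T. Bałaban, *Propagators and renormalization transformations for lattice gauge
theories. II*, Commun. Math. Phys. **96** (1984) 223–250 [`Balaban1984PropagatorsII`].

statement-level skeleton of published theorems with citation tags; proofs where landed; nothing here is a claim about the Yang–Mills
mass gap

THE PRINTED LOCUS (held text `paper:balaban1985-cmp99-background-propagators`).  p. 426, (3.152): *"RD\*G₁ = RG′D\*, and G₁DR = DG′R"*; p. 426:
*"The formulas (3.147), (3.153) permit us to reduce properties of the operators 𝔓, 𝔊 to the corresponding properties of the operators G′, (Q′G′²Q′\*)⁻¹,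
G₁, (QG₁Q\*)⁻¹"*; Theorem 3.1 p. 397–398: (3.42)₂,₃ (|∇_UG′λ|, |G′∇\*_Uλ| ≦ B₀Lʲη·e^{−δ₀d}|λ|) and (3.46)₄ (‖1_{Δ(y)}∇_UG′∇\*_Uλ‖ ≦ B₀e^{−δ₀d(y,y′)}‖λ‖, prefactor 1);
(3.49) p. 399 (P and ∇P, P = I − ϱ⁻¹R); p. 398 (remark after (3.47): the powers of Lʲη may be split between the two localisations — [4] (2.60)); p. 391
(the L² adjoints).

THE POINT (sequel of `B9Thm313WholeLettersCut` + `B9Thm313WholeRgdFrom3152`, same seat).  The re-cut block-L² schema `Letters313L2Pc` of the N06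
LETTERS-SPECIES RE-CUT displays two NEW order-zero letters in place of the located third-order ones: `vDRDG` — ‖1_{Δ(y)}D R D\*G₁μ‖₂ ≦
B₄·(L^{j′}η∕Lʲη)·e^{−δd}‖μ‖₂ — and `vGDRD` — ‖1_{Δ(y)}G₁D R D\*f‖₂ ≦ B₄·(Lʲη∕L^{j′}η)·e^{−δd}‖f‖₂.  By (3.152) they are words in the SITE propagator G′:
D R D\*G₁ = D·R·G′·D\* = ϱ(DG′D\* − (DP)(G′D\*)) and G₁D R D\* = D·G′·R·D\* = ϱ(DG′D\* − (DG′)(PD\*)).  THIS FILE proves both displayed shapes from letters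
the N06 certificate ALREADY derives or closes at its pins: the block-L² line (3.46)₄ of DG′D\* (`hDGD`; closed at the pins by dag-n06-w7's
`B9Eq346GradGpDivAtPinsL2Closed.blockBd_DvGcoSDvs_memberY_at`), Theorem 3.1's sup entries for G′ (`Thm31GpMaj`, rows 18's derived h31), (3.49) (`Proj349Maj`,
the derived h49), R = ϱ•(I − P), the transposition letters (G′, P symmetric; Dᵀ = D\*; p. 391), the member facts `Facts347` and the row sum:
* §1 `hasMajorantHom_DvPGpDvs` ∕ `hasMajorantHom_DvGpPDvs` — the sup majorants of the order-zero words (DP)(G′D\*) and (DG′)(PD\*) (kernel C·e^{−ρd}, no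
  length prefactor: [4] (2.54) in the real-exponent classes with one (2.60) shift), `blockBd_DvPGpDvs` ∕ `blockBd_DvGpPDvs` — their block-L² bounds by the Schur
  test (each is the other's transpose);
* §2 ★★ `vDRDG_of_ids3152`, ★★ `vGDRD_of_ids3152` — the two `Letters313L2Pc` fields' statements, constant any B₄ ≧ ϱ·L₀·(B_D + C_P·L₀·B₀·c), rate any
  δ₄ ≦ δ − σ − 2αδ (δ the member-facts rate, ≦ δ₀, δ_P; B_D's rate ≧ δ − σ − αδ).
So after this file the re-cut L² schema's NEW letters are theorems of rows 18's material + (3.152); what it still DISPLAYS beyond the parent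
`Letters313L2PZ` is the printed identity `Ids3152` alone.

HONEST SCOPE.  Kernel bookkeeping over landed modules; NOTHING of print's estimates is asserted; (3.152) and (3.46)₄-for-G′ enter as hypotheses of printed
species (the latter closed at the pins elsewhere).  COUNT-NEUTRAL; N06 NOT discharged; one finite lattice at a time; nothing continuum, nothing about the
mass gap ∕ Clay.  Cell `pub-ymgap` (HUMAN RULING D-0062), Track A node N06 [B9], bundle F7 rows 20–21, seat `pub-ymgap-dag-n06-l` (g19), 2026-08-28.  NEW file.
-/

namespace Literature.MathematicalPhysics.QuantumFieldTheory.Balaban1983to89.B9Thm313WholeCutLettersL2From3152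

open Literature.MathematicalPhysics.QuantumFieldTheory.Balaban1983to89
open Finset B6RandomWalk B6RandomWalkHom B9Thm34Ext B11SectG B9SectDSup B9SectDL2Decay B9Thm37Glue B9Thm312Whole
open B9Thm312WholeClasses B9RWSums343to347Whole B9RWSums346Schur B9PerturbationMajorantAlgebra B9PerturbationMajorantLetters
open B9Thm313WholeRgdFrom3152

noncomputable section

variable {g : B9.Geometry} {B : B9.Backgrounds} {X Y Z W : Type} [Fintype X] [Fintype W] [Fintype g.Site]
variable {R₀ : ℝ} {H₀ : Prop}

/-! ## §1 The order-zero words (DP)(G′D\*) and (DG′)(PD\*): sup majorants and block-L² bounds -/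

/-- **THE ORDER-ZERO WORD (∇P)(G′∇\*) IN THE SUP CLASSES**: from (3.49) for ∇P (`Proj349Maj.p1`, kernel C_P(Lʲη)⁻¹e^{−δd}) shifted by [4] (2.60) to the class
𝔠^{(1)} → 𝔠^{(0)} (constant C_P·L, rate δ − αδ) and Theorem 3.1 (3.42)₃ for G′∇\* (`Thm31GpMaj.e2`, 𝔠^{(0)} → 𝔠^{(1)}), one composition at the margin σ:
|(∇P G′∇\*μ)(x)| ≦ C_P·L·B₀·c·e^{−ρd(y,y′)}|μ| for x ∈ Δ(y), supp μ ⊂ Δ(y′), every 0 ≦ ρ ≦ δ − σ − αδ (δ ≦ δ₀, δ_P the member-facts rate).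
[cite: Balaban1985BackgroundPropagators, Thm 3.1 (3.42) p.397 + (3.49) p.399 + p.398 (remark after (3.47)); Balaban1984PropagatorsII, (2.54) p.233 + Lemma 2.1 (2.60)–(2.61) p.234] -/
theorem hasMajorantHom_DvPGpDvs (hG : GeoOK g) {dF : ℕ} {δ α L₀ σ c : ℝ} (hF : Facts347 g R₀ H₀ dF δ α L₀)
    (hrow : RowSum (toB6 g R₀ H₀) σ c) {blkW : W → g.Site} {blk : X → g.Site}
    {Gp P : Module.End ℝ (W → ℝ)} {Dv : (W → ℝ) →ₗ[ℝ] (X → ℝ)} {Dvs : (X → ℝ) →ₗ[ℝ] (W → ℝ)} {B₀ δ₀ CP δP ρ : ℝ}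
    (h31 : Thm31GpMaj blkW blk Gp Dv Dvs R₀ H₀ B₀ δ₀) (h49 : Proj349Maj blkW blk P Dv Dvs R₀ H₀ CP δP)
    (hB₀ : 0 ≤ B₀) (hCP : 0 ≤ CP) (hσ : 0 ≤ σ) (hαδ : 0 ≤ α * δ) (hδ₀ : δ ≤ δ₀) (hδP : δ ≤ δP) (hρ : 0 ≤ ρ)
    (hρδ : ρ + σ + α * δ ≤ δ) :
    HasMajorantHom (g := toB6 g R₀ H₀) blk blk ((Dv ∘ₗ P) ∘ₗ (Gp ∘ₗ Dvs))
      (fun (a b : g.Site) => CP * g.L * B₀ * c * Real.exp (-(ρ * g.dist a b))) := by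
  have htri : Triangle254 (toB6 g R₀ H₀) := fun a b c => hG.tri a b c
  have hc : 0 ≤ c ∨ IsEmpty g.Site := by
    by_cases hne : Nonempty g.Site
    · exact Or.inl (hrow.nonneg hne.some)
    · exact Or.inr (not_nonempty_iff.mp hne)
  have hL0 : 0 ≤ g.L := zero_le_one.trans hF.one_le_L
  -- G′D* : 𝔠^{(0)} → 𝔠^{(1)}_W  (cNormR exponents 0 → −1), rate δ
  have hGD := h31.gpDvs_cls hG hB₀ hδ₀
  -- DP : 𝔠^{(0)}_W → 𝔠^{(−1)} (exponents 0 → 1), shifted by γ = −1 to 𝔠^{(1)}_W → 𝔠^{(0)} (exponents −1 → 0): constant C_P·L, rate δ − αδ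
  have hDP0 := h49.dvP_cls hG hCP hδP
  have hDP := hasMaj_shift hG hF (-1) (by norm_num) hCP hDP0
  rw [rpow_abs_eq_pow g.L (-1) 1 (by norm_num), pow_one] at hDP
  have e1 : ((0 : ℝ) + -1) = -1 := by norm_num
  have e2 : ((1 : ℝ) + -1) = 0 := by norm_num
  rw [e1, e2] at hDP
  -- one composition ([4] (2.54) + (2.61)) at the rate ρ
  have hcomp := hasMaj_comp_exp (b₁ := cNormR R₀ H₀ blk hG.lenle 0) (b₂ := cNormR R₀ H₀ blkW hG.lenle (-1))
    (b₃ := cNormR R₀ H₀ blk hG.lenle 0) htri hG.dnn hrow (mul_nonneg hCP hL0) hB₀ hρ (by linarith) (by linarith) hDP hGD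
  simp only [cNormR_κ, one_mul] at hcomp
  have hcomp' : HasMaj (cNormR R₀ H₀ blk hG.lenle 0) (cNormR R₀ H₀ blk hG.lenle 0) ((Dv ∘ₗ P) ∘ₗ (Gp ∘ₗ Dvs))
      (fun a b => CP * g.L * B₀ * c * Real.exp (-(ρ * g.dist a b))) :=
    hcomp.mono fun a b => le_of_eq (by simp only [toB6_dist])
  -- back to the two-space sup form (exponents 0, 0: no length factors)
  have hK : ∀ a b : g.Site, 0 ≤ CP * g.L * B₀ * c * Real.exp (-(ρ * g.dist a b)) := by
    rcases hc with hc | hemp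
    · exact fun a b => mul_nonneg (mul_nonneg (mul_nonneg (mul_nonneg hCP hL0) hB₀) hc) (Real.exp_nonneg _)
    · exact fun a _ => (hemp.false a).elim
  have h := hasMajorantHom_of_hasMaj_cNormR hG hK hcomp'
  refine hasMajorantHom_mono (g := toB6 g R₀ H₀) blk blk h fun a b => le_of_eq ?_
  simp only [neg_zero, Real.rpow_zero, mul_one]

/-- **THE ORDER-ZERO WORD (∇G′)(P∇\*) IN THE SUP CLASSES** (the transpose word): from (3.49) for P∇\* (`Proj349Maj.p2`, 𝔠^{(0)} → 𝔠^{(−1)}_W) and Theorem 3.1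
(3.42)₂ for ∇G′ (`Thm31GpMaj.e1`) shifted by (2.60) to 𝔠^{(−1)}_W → 𝔠^{(0)} (constant B₀·L, rate δ − αδ), one composition at the margin σ:
|(∇G′ P∇\*f)(x)| ≦ B₀·L·C_P·c·e^{−ρd(y,y′)}|f| (0 ≦ ρ ≦ δ − σ − αδ).
[cite: Balaban1985BackgroundPropagators, Thm 3.1 (3.42) p.397 + (3.49) p.399 + p.398 (remark after (3.47)); Balaban1984PropagatorsII, (2.54) p.233 + Lemma 2.1 (2.60)–(2.61) p.234] -/
theorem hasMajorantHom_DvGpPDvs (hG : GeoOK g) {dF : ℕ} {δ α L₀ σ c : ℝ} (hF : Facts347 g R₀ H₀ dF δ α L₀)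
    (hrow : RowSum (toB6 g R₀ H₀) σ c) {blkW : W → g.Site} {blk : X → g.Site}
    {Gp P : Module.End ℝ (W → ℝ)} {Dv : (W → ℝ) →ₗ[ℝ] (X → ℝ)} {Dvs : (X → ℝ) →ₗ[ℝ] (W → ℝ)} {B₀ δ₀ CP δP ρ : ℝ}
    (h31 : Thm31GpMaj blkW blk Gp Dv Dvs R₀ H₀ B₀ δ₀) (h49 : Proj349Maj blkW blk P Dv Dvs R₀ H₀ CP δP)
    (hB₀ : 0 ≤ B₀) (hCP : 0 ≤ CP) (hσ : 0 ≤ σ) (hαδ : 0 ≤ α * δ) (hδ₀ : δ ≤ δ₀) (hδP : δ ≤ δP) (hρ : 0 ≤ ρ)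
    (hρδ : ρ + σ + α * δ ≤ δ) :
    HasMajorantHom (g := toB6 g R₀ H₀) blk blk ((Dv ∘ₗ Gp) ∘ₗ (P ∘ₗ Dvs))
      (fun (a b : g.Site) => CP * g.L * B₀ * c * Real.exp (-(ρ * g.dist a b))) := by
  have htri : Triangle254 (toB6 g R₀ H₀) := fun a b c => hG.tri a b c
  have hc : 0 ≤ c ∨ IsEmpty g.Site := by
    by_cases hne : Nonempty g.Site
    · exact Or.inl (hrow.nonneg hne.some)
    · exact Or.inr (not_nonempty_iff.mp hne)
  have hL0 : 0 ≤ g.L := zero_le_one.trans hF.one_le_L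
  -- PD* : 𝔠^{(0)} → 𝔠^{(−1)}_W (exponents 0 → 1), rate δ
  have hPD := h49.pDvs_cls hG hCP hδP
  -- DG′ : 𝔠^{(0)}_W → 𝔠^{(1)} (exponents 0 → −1), shifted by γ = +1 to 𝔠^{(−1)}_W → 𝔠^{(0)} (exponents 1 → 0): constant B₀·L, rate δ − αδ
  have hDG0 := h31.dvGp_cls hG hB₀ hδ₀
  have hDG := hasMaj_shift hG hF 1 (by norm_num) hB₀ hDG0
  rw [rpow_abs_eq_pow g.L 1 1 (by norm_num), pow_one] at hDG
  have e1 : ((0 : ℝ) + 1) = 1 := by norm_num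
  have e2 : ((-1 : ℝ) + 1) = 0 := by norm_num
  rw [e1, e2] at hDG
  have hcomp := hasMaj_comp_exp (b₁ := cNormR R₀ H₀ blk hG.lenle 0) (b₂ := cNormR R₀ H₀ blkW hG.lenle 1)
    (b₃ := cNormR R₀ H₀ blk hG.lenle 0) htri hG.dnn hrow (mul_nonneg hB₀ hL0) hCP hρ (by linarith) (by linarith) hDG hPD
  simp only [cNormR_κ, one_mul] at hcomp
  have hcomp' : HasMaj (cNormR R₀ H₀ blk hG.lenle 0) (cNormR R₀ H₀ blk hG.lenle 0) ((Dv ∘ₗ Gp) ∘ₗ (P ∘ₗ Dvs))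
      (fun a b => CP * g.L * B₀ * c * Real.exp (-(ρ * g.dist a b))) :=
    hcomp.mono fun a b => le_of_eq (by simp only [toB6_dist]; ring)
  have hK : ∀ a b : g.Site, 0 ≤ CP * g.L * B₀ * c * Real.exp (-(ρ * g.dist a b)) := by
    rcases hc with hc | hemp
    · exact fun a b => mul_nonneg (mul_nonneg (mul_nonneg (mul_nonneg hCP hL0) hB₀) hc) (Real.exp_nonneg _)
    · exact fun a _ => (hemp.false a).elim
  have h := hasMajorantHom_of_hasMaj_cNormR hG hK hcomp'
  refine hasMajorantHom_mono (g := toB6 g R₀ H₀) blk blk h fun a b => le_of_eq ?_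
  simp only [neg_zero, Real.rpow_zero, mul_one]

/-- (DP)(G′D\*) and (DG′)(PD\*) are each other's transposes (G′, P symmetric; Dᵀ = D\*; p. 391). [cite: Balaban1985BackgroundPropagators, p.391 (the L² adjoints) + (3.49) p.399] -/
theorem isTransposePair_DvPGpDvs {Gp P : Module.End ℝ (W → ℝ)} {Dv : (W → ℝ) →ₗ[ℝ] (X → ℝ)} {Dvs : (X → ℝ) →ₗ[ℝ] (W → ℝ)}
    (hGpT : IsTransposePair Gp Gp) (hDvT : IsTransposePair Dv Dvs) (hPT : IsTransposePair P P) :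
    IsTransposePair ((Dv ∘ₗ P) ∘ₗ (Gp ∘ₗ Dvs)) ((Dv ∘ₗ Gp) ∘ₗ (P ∘ₗ Dvs)) :=
  (hDvT.symm.comp hGpT).comp (hPT.comp hDvT)

/-- **(DP)(G′D\*) IN BLOCK-L²** by the Schur test from its sup majorant and its transpose's: ‖1_{Δ(y)}∇P G′∇\*μ‖₂ ≦ C_P·L·B₀·c·e^{−ρd(y,y′)}‖μ‖₂ (supp μ ⊂ Δ(y′)).
[cite: Balaban1985BackgroundPropagators, (3.46) p.398 + Thm 3.1 (3.42) p.397 + (3.49) p.399 + p.391; Schur's test, folklore] -/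
theorem blockBd_DvPGpDvs (hG : GeoOK g) {dF : ℕ} {δ α L₀ σ c : ℝ} (hF : Facts347 g R₀ H₀ dF δ α L₀)
    (hrow : RowSum (toB6 g R₀ H₀) σ c) {blkW : W → g.Site} {blk : X → g.Site}
    {Gp P : Module.End ℝ (W → ℝ)} {Dv : (W → ℝ) →ₗ[ℝ] (X → ℝ)} {Dvs : (X → ℝ) →ₗ[ℝ] (W → ℝ)} {B₀ δ₀ CP δP ρ : ℝ}
    (h31 : Thm31GpMaj blkW blk Gp Dv Dvs R₀ H₀ B₀ δ₀) (h49 : Proj349Maj blkW blk P Dv Dvs R₀ H₀ CP δP)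
    (hGpT : IsTransposePair Gp Gp) (hDvT : IsTransposePair Dv Dvs) (hPT : IsTransposePair P P)
    (hB₀ : 0 ≤ B₀) (hCP : 0 ≤ CP) (hc : 0 ≤ c) (hσ : 0 ≤ σ) (hαδ : 0 ≤ α * δ) (hδ₀ : δ ≤ δ₀) (hδP : δ ≤ δP) (hρ : 0 ≤ ρ)
    (hρδ : ρ + σ + α * δ ≤ δ) :
    BlockBd (g := toB6 g R₀ H₀) blk blk ((Dv ∘ₗ P) ∘ₗ (Gp ∘ₗ Dvs))
      (fun (y y' : g.Site) => CP * g.L * B₀ * c * Real.exp (-(ρ * g.dist y y'))) := by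
  have hL0 : 0 ≤ g.L := zero_le_one.trans hF.one_le_L
  have hK : ∀ a b : g.Site, 0 ≤ CP * g.L * B₀ * c * Real.exp (-(ρ * g.dist a b)) := fun a b =>
    mul_nonneg (mul_nonneg (mul_nonneg (mul_nonneg hCP hL0) hB₀) hc) (Real.exp_nonneg _)
  have h1 := hasMajorantHom_DvPGpDvs hG hF hrow h31 h49 hB₀ hCP hσ hαδ hδ₀ hδP hρ hρδ
  have h2 := hasMajorantHom_DvGpPDvs hG hF hrow h31 h49 hB₀ hCP hσ hαδ hδ₀ hδP hρ hρδ
  refine (blockBd_schur (G := toB6 g R₀ H₀) blk blk hK hK h1 h2 (isTransposePair_DvPGpDvs hGpT hDvT hPT)).mono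
    fun y y' => le_of_eq ?_
  show Real.sqrt (CP * g.L * B₀ * c * Real.exp (-(ρ * g.dist y y')) * (CP * g.L * B₀ * c * Real.exp (-(ρ * g.dist y' y)))) =
    CP * g.L * B₀ * c * Real.exp (-(ρ * g.dist y y'))
  rw [hG.symm y' y, Real.sqrt_mul_self (hK y y')]

/-- **(DG′)(PD\*) IN BLOCK-L²** (the transpose word, same bound). [cite: Balaban1985BackgroundPropagators, (3.46) p.398 + Thm 3.1 (3.42) p.397 + (3.49) p.399 + p.391; Schur's test, folklore] -/
theorem blockBd_DvGpPDvs (hG : GeoOK g) {dF : ℕ} {δ α L₀ σ c : ℝ} (hF : Facts347 g R₀ H₀ dF δ α L₀)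
    (hrow : RowSum (toB6 g R₀ H₀) σ c) {blkW : W → g.Site} {blk : X → g.Site}
    {Gp P : Module.End ℝ (W → ℝ)} {Dv : (W → ℝ) →ₗ[ℝ] (X → ℝ)} {Dvs : (X → ℝ) →ₗ[ℝ] (W → ℝ)} {B₀ δ₀ CP δP ρ : ℝ}
    (h31 : Thm31GpMaj blkW blk Gp Dv Dvs R₀ H₀ B₀ δ₀) (h49 : Proj349Maj blkW blk P Dv Dvs R₀ H₀ CP δP)
    (hGpT : IsTransposePair Gp Gp) (hDvT : IsTransposePair Dv Dvs) (hPT : IsTransposePair P P)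
    (hB₀ : 0 ≤ B₀) (hCP : 0 ≤ CP) (hc : 0 ≤ c) (hσ : 0 ≤ σ) (hαδ : 0 ≤ α * δ) (hδ₀ : δ ≤ δ₀) (hδP : δ ≤ δP) (hρ : 0 ≤ ρ)
    (hρδ : ρ + σ + α * δ ≤ δ) :
    BlockBd (g := toB6 g R₀ H₀) blk blk ((Dv ∘ₗ Gp) ∘ₗ (P ∘ₗ Dvs))
      (fun (y y' : g.Site) => CP * g.L * B₀ * c * Real.exp (-(ρ * g.dist y y'))) := by
  have hL0 : 0 ≤ g.L := zero_le_one.trans hF.one_le_L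
  have hK : ∀ a b : g.Site, 0 ≤ CP * g.L * B₀ * c * Real.exp (-(ρ * g.dist a b)) := fun a b =>
    mul_nonneg (mul_nonneg (mul_nonneg (mul_nonneg hCP hL0) hB₀) hc) (Real.exp_nonneg _)
  have h1 := hasMajorantHom_DvPGpDvs hG hF hrow h31 h49 hB₀ hCP hσ hαδ hδ₀ hδP hρ hρδ
  have h2 := hasMajorantHom_DvGpPDvs hG hF hrow h31 h49 hB₀ hCP hσ hαδ hδ₀ hδP hρ hρδ
  refine (blockBd_schur (G := toB6 g R₀ H₀) blk blk hK hK h2 h1 (isTransposePair_DvPGpDvs hGpT hDvT hPT).symm).mono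
    fun y y' => le_of_eq ?_
  show Real.sqrt (CP * g.L * B₀ * c * Real.exp (-(ρ * g.dist y y')) * (CP * g.L * B₀ * c * Real.exp (-(ρ * g.dist y' y)))) =
    CP * g.L * B₀ * c * Real.exp (-(ρ * g.dist y y'))
  rw [hG.symm y' y, Real.sqrt_mul_self (hK y y')]

/-! ## §2 The two order-zero letters of `Letters313L2Pc` from (3.152) -/

omit [Fintype W] in
/-- A block-L² bound for ϱ·(T₁ − T₂) from bounds for T₁, T₂ at a common exponential rate (ϱ ≧ 0): constants add (p. 232: *"A summation preserves it also"*).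
[cite: Balaban1984PropagatorsII, p.232] -/
private theorem blockBd_smul_sub {V : Type} [Fintype V] {blkV : V → g.Site} {blk : X → g.Site}
    {T T₁ T₂ : (V → ℝ) →ₗ[ℝ] (X → ℝ)} {C₁ C₂ ρ ϱ : ℝ} (hϱ : 0 ≤ ϱ)
    (h₁ : BlockBd (g := toB6 g R₀ H₀) blkV blk T₁ (fun (y y' : g.Site) => C₁ * Real.exp (-(ρ * g.dist y y'))))
    (h₂ : BlockBd (g := toB6 g R₀ H₀) blkV blk T₂ (fun (y y' : g.Site) => C₂ * Real.exp (-(ρ * g.dist y y'))))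
    (hT : ∀ μ, T μ = ϱ • (T₁ μ - T₂ μ)) :
    BlockBd (g := toB6 g R₀ H₀) blkV blk T (fun (y y' : g.Site) => ϱ * (C₁ + C₂) * Real.exp (-(ρ * g.dist y y'))) := by
  have h₁' := (blockBd_iff_hasMaj (g := toB6 g R₀ H₀) blkV blk T₁ _).mp h₁
  have h₂' := (blockBd_iff_hasMaj (g := toB6 g R₀ H₀) blkV blk T₂ _).mp h₂
  have hsub := hasMaj_sub_exp h₁' h₂'
  refine (blockBd_iff_hasMaj (g := toB6 g R₀ H₀) blkV blk T _).mpr ?_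
  intro y' μ hμ y
  have hb := hsub y' μ hμ y
  rw [l2w_loc] at hb ⊢
  rw [hT μ, ← LinearMap.sub_apply, bl2_smul, abs_of_nonneg hϱ]
  calc (1 : ℝ) * (ϱ * bl2 (g := toB6 g R₀ H₀) blk y ((T₁ - T₂) μ)) = ϱ * ((1 : ℝ) * bl2 (g := toB6 g R₀ H₀) blk y ((T₁ - T₂) μ)) := by
        ring
    _ ≤ ϱ * ((C₁ + C₂) * Real.exp (-(ρ * g.dist y y')) *
          (l2w (toB6 g R₀ H₀) blkV (fun _ => (1 : ℝ)) (fun _ => zero_le_one)).loc y' μ) :=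
        mul_le_mul_of_nonneg_left hb hϱ
    _ = ϱ * (C₁ + C₂) * Real.exp (-(ρ * g.dist y y')) *
          (l2w (toB6 g R₀ H₀) blkV (fun _ => (1 : ℝ)) (fun _ => zero_le_one)).loc y' μ := by ring

omit [Fintype W] in
/-- **THE SCALE FACTORS OF (3.46) MOVED INTO THE KERNEL** ([4] (2.60), p. 398's remark): a prefactor-free block bound C·e^{−ρd} is bounded by
C·L·(L^{j′}η∕Lʲη)·e^{−(ρ−αδ)d} and by C·L·(Lʲη∕L^{j′}η)·e^{−(ρ−αδ)d} (Lʲη ≦ L·e^{αδd(y,y′)}·L^{j′}η both ways).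
[cite: Balaban1985BackgroundPropagators, p.398 (remark after (3.47)); Balaban1984PropagatorsII, Lemma 2.1 (2.60) p.234] -/
private theorem blockBd_ratio_of_flat {V : Type} [Fintype V] (hG : GeoOK g) {dF : ℕ} {δ α L₀ : ℝ} (hF : Facts347 g R₀ H₀ dF δ α L₀)
    {blkV : V → g.Site} {blk : X → g.Site} {T : (V → ℝ) →ₗ[ℝ] (X → ℝ)} {C ρ : ℝ} (hC : 0 ≤ C)
    (h : BlockBd (g := toB6 g R₀ H₀) blkV blk T (fun (y y' : g.Site) => C * Real.exp (-(ρ * g.dist y y')))) :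
    BlockBd (g := toB6 g R₀ H₀) blkV blk T
        (fun (y y' : g.Site) => C * g.L * ((g.len y)⁻¹ * g.len y') * Real.exp (-((ρ - α * δ) * g.dist y y'))) ∧
      BlockBd (g := toB6 g R₀ H₀) blkV blk T
        (fun (y y' : g.Site) => C * g.L * (g.len y * (g.len y')⁻¹) * Real.exp (-((ρ - α * δ) * g.dist y y'))) := by
  have hST := scaleTransfer_len_rpow hF 1 (by norm_num)
  simp only [abs_one, Real.rpow_one] at hST
  have hsplit : ∀ y y' : g.Site, Real.exp (-(ρ * g.dist y y')) =
      Real.exp (-(α * δ * g.dist y y')) * Real.exp (-((ρ - α * δ) * g.dist y y')) := fun y y' => by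
    rw [← Real.exp_add]; congr 1; ring
  refine ⟨h.mono fun y y' => ?_, h.mono fun y y' => ?_⟩
  · -- len y · e^{−αδd} ≦ L · len y′
    have ht : Real.exp (-(α * δ * g.dist y y')) * g.len y ≤ g.L * g.len y' := by
      have h0 := hST y' y
      rw [hG.symm y' y] at h0
      exact h0
    have hy : 0 < g.len y := hG.lenpos y
    have hE : 0 ≤ Real.exp (-((ρ - α * δ) * g.dist y y')) := Real.exp_nonneg _
    have key : Real.exp (-(α * δ * g.dist y y')) ≤ g.L * ((g.len y)⁻¹ * g.len y') := by
      have h1 : Real.exp (-(α * δ * g.dist y y')) ≤ g.L * g.len y' / g.len y := by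
        rw [le_div_iff₀ hy]; exact ht
      calc Real.exp (-(α * δ * g.dist y y')) ≤ g.L * g.len y' / g.len y := h1
        _ = g.L * ((g.len y)⁻¹ * g.len y') := by rw [div_eq_mul_inv]; ring
    rw [hsplit y y']
    calc C * (Real.exp (-(α * δ * g.dist y y')) * Real.exp (-((ρ - α * δ) * g.dist y y')))
        = C * Real.exp (-((ρ - α * δ) * g.dist y y')) * Real.exp (-(α * δ * g.dist y y')) := by ring
      _ ≤ C * Real.exp (-((ρ - α * δ) * g.dist y y')) * (g.L * ((g.len y)⁻¹ * g.len y')) :=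
          mul_le_mul_of_nonneg_left key (mul_nonneg hC hE)
      _ = C * g.L * ((g.len y)⁻¹ * g.len y') * Real.exp (-((ρ - α * δ) * g.dist y y')) := by ring
  · -- len y′ · e^{−αδd} ≦ L · len y
    have ht : Real.exp (-(α * δ * g.dist y y')) * g.len y' ≤ g.L * g.len y := hST y y'
    have hy' : 0 < g.len y' := hG.lenpos y'
    have hE : 0 ≤ Real.exp (-((ρ - α * δ) * g.dist y y')) := Real.exp_nonneg _
    have key : Real.exp (-(α * δ * g.dist y y')) ≤ g.L * (g.len y * (g.len y')⁻¹) := by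
      have h1 : Real.exp (-(α * δ * g.dist y y')) ≤ g.L * g.len y / g.len y' := by
        rw [le_div_iff₀ hy']; exact ht
      calc Real.exp (-(α * δ * g.dist y y')) ≤ g.L * g.len y / g.len y' := h1
        _ = g.L * (g.len y * (g.len y')⁻¹) := by rw [div_eq_mul_inv]; ring
    rw [hsplit y y']
    calc C * (Real.exp (-(α * δ * g.dist y y')) * Real.exp (-((ρ - α * δ) * g.dist y y')))
        = C * Real.exp (-((ρ - α * δ) * g.dist y y')) * Real.exp (-(α * δ * g.dist y y')) := by ring
      _ ≤ C * Real.exp (-((ρ - α * δ) * g.dist y y')) * (g.L * (g.len y * (g.len y')⁻¹)) :=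
          mul_le_mul_of_nonneg_left key (mul_nonneg hC hE)
      _ = C * g.L * (g.len y * (g.len y')⁻¹) * Real.exp (-((ρ - α * δ) * g.dist y y')) := by ring

/-- ★★ **THE ORDER-ZERO LETTER D R D\*G₁ OF THE RE-CUT L² SCHEMA (`Letters313L2Pc.vDRDG`) IS D R G′D\* BY (3.152)** — PROVED: from `Ids3152.rd`
(RD\*G₁ = RG′D\*), R = ϱ•(I − P), the block-L² line (3.46)₄ of DG′D\* (`hDGD`, constant B_D, rate δ_D ≧ δ − σ − αδ), Theorem 3.1 for G′ (`Thm31GpMaj`),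
(3.49) (`Proj349Maj`), the transposition letters, the member facts `Facts347` (rate δ ≦ δ₀, δ_P) and the row sum: D R D\*G₁ = ϱ(DG′D\* − (DP)(G′D\*)) has
the prefactor-free block bound ϱ(B_D + C_P·L·B₀·c)·e^{−(δ−σ−αδ)d}, whence — moving one scale factor into the kernel by (2.60) — the displayed shape
‖1_{Δ(y)}D R D\*G₁μ‖₂ ≦ B₄·(L^{j′}η∕Lʲη)·e^{−δ₄d(y,y′)}‖μ‖₂ for any B₄ ≧ ϱ·L₀·(B_D + C_P·L₀·B₀·c) and any δ₄ ≦ δ − σ − 2αδ.  Nothing of print asserted.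
[cite: Balaban1985BackgroundPropagators, (3.152)–(3.153) p.426 + Thm 3.1 (3.42)+(3.46) pp.397–398 + (3.49) p.399 + p.391 + Thm 3.13 p.426; Balaban1984PropagatorsII, (2.52)–(2.56) pp.232–233 + Lemma 2.1 (2.60)–(2.61) p.234] -/
theorem vDRDG_of_ids3152 (hG : GeoOK g) {dF : ℕ} {δ α L₀ σ c : ℝ} (hF : Facts347 g R₀ H₀ dF δ α L₀)
    (hrow : RowSum (toB6 g R₀ H₀) σ c) {𝔬 : Ops g B X Y Z W} {Gp P : B.Cfg → Module.End ℝ (W → ℝ)} {U : B.Cfg}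
    {B₀ δ₀ CP δP BD δD ϱ B₄ δ₄ : ℝ}
    (h31 : Thm31GpMaj 𝔬.blkW 𝔬.blk (Gp U) (𝔬.Dv U) (𝔬.Dvstar U) R₀ H₀ B₀ δ₀)
    (h49 : Proj349Maj 𝔬.blkW 𝔬.blk (P U) (𝔬.Dv U) (𝔬.Dvstar U) R₀ H₀ CP δP)
    (hDGD : BlockBd (g := toB6 g R₀ H₀) 𝔬.blk 𝔬.blk (𝔬.Dv U ∘ₗ Gp U ∘ₗ 𝔬.Dvstar U)
      (fun (y y' : g.Site) => BD * Real.exp (-(δD * g.dist y y'))))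
    (hR : 𝔬.R U = ϱ • (LinearMap.id - P U)) (h152 : Ids3152 𝔬 Gp U)
    (hGpT : IsTransposePair (Gp U) (Gp U)) (hDvT : IsTransposePair (𝔬.Dv U) (𝔬.Dvstar U)) (hPT : IsTransposePair (P U) (P U))
    (hϱ : 0 ≤ ϱ) (hB₀ : 0 ≤ B₀) (hCP : 0 ≤ CP) (hBD : 0 ≤ BD) (hc : 0 ≤ c) (hσ : 0 ≤ σ) (hαδ : 0 ≤ α * δ) (hδ₀ : δ ≤ δ₀)
    (hδP : δ ≤ δP)
    (hbud : 0 ≤ δ - σ - α * δ) (hδD : δ - σ - α * δ ≤ δD)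
    (hB₄ : ϱ * L₀ * (BD + CP * L₀ * B₀ * c) ≤ B₄) (hδ₄ : δ₄ ≤ δ - σ - 2 * (α * δ)) :
    BlockBd (g := toB6 g R₀ H₀) 𝔬.blk 𝔬.blk (𝔬.Dv U ∘ₗ 𝔬.R U ∘ₗ 𝔬.Dvstar U ∘ₗ 𝔬.G1 U)
      (fun (y y' : g.Site) => B₄ * ((g.len y)⁻¹ * g.len y') * Real.exp (-(δ₄ * g.dist y y'))) := by
  have hL0 : 0 ≤ g.L := zero_le_one.trans hF.one_le_L
  have hL₀ : g.L ≤ L₀ := hF.L_le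
  set ρ : ℝ := δ - σ - α * δ with hρdef
  have hρ : 0 ≤ ρ := hbud
  have hρδ : ρ + σ + α * δ ≤ δ := by rw [hρdef]; linarith
  -- the two words in block-L² at the rate ρ
  have hT₂ := blockBd_DvPGpDvs hG hF hrow h31 h49 hGpT hDvT hPT hB₀ hCP hc hσ hαδ hδ₀ hδP hρ hρδ
  have hT₁ : BlockBd (g := toB6 g R₀ H₀) 𝔬.blk 𝔬.blk (𝔬.Dv U ∘ₗ Gp U ∘ₗ 𝔬.Dvstar U)
      (fun (y y' : g.Site) => BD * Real.exp (-(ρ * g.dist y y'))) :=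
    hDGD.mono fun y y' => mul_le_mul_of_nonneg_left
      (Real.exp_le_exp.mpr (neg_le_neg (mul_le_mul_of_nonneg_right hδD (hG.dnn y y')))) hBD
  -- D R D*G₁ = ϱ(DG′D* − (DP)(G′D*)) pointwise, by (3.152) and R = ϱ(I − P)
  have hid : ∀ μ, (𝔬.Dv U ∘ₗ 𝔬.R U ∘ₗ 𝔬.Dvstar U ∘ₗ 𝔬.G1 U) μ =
      ϱ • ((𝔬.Dv U ∘ₗ Gp U ∘ₗ 𝔬.Dvstar U) μ - ((𝔬.Dv U ∘ₗ P U) ∘ₗ (Gp U ∘ₗ 𝔬.Dvstar U)) μ) := fun μ => by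
    have e := h152.rd_apply μ
    simp only [LinearMap.comp_apply, LinearMap.id_apply] at e
    simp only [LinearMap.comp_apply]
    rw [e, hR]
    simp only [LinearMap.smul_apply, LinearMap.sub_apply, LinearMap.id_apply, map_smul, map_sub]
  have hflat := blockBd_smul_sub hϱ hT₁ hT₂ hid
  -- one scale factor into the kernel
  have hC0 : 0 ≤ ϱ * (BD + CP * g.L * B₀ * c) :=
    mul_nonneg hϱ (add_nonneg hBD (mul_nonneg (mul_nonneg (mul_nonneg hCP hL0) hB₀) hc))
  have h := (blockBd_ratio_of_flat hG hF hC0 hflat).1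
  refine h.mono fun y y' => ?_
  have hW : 0 ≤ (g.len y)⁻¹ * g.len y' := mul_nonneg (inv_nonneg.mpr (hG.lenle y)) (hG.lenle y')
  have hK : ϱ * (BD + CP * g.L * B₀ * c) * g.L ≤ B₄ := by
    calc ϱ * (BD + CP * g.L * B₀ * c) * g.L ≤ ϱ * (BD + CP * L₀ * B₀ * c) * L₀ := by
          have h1 : CP * g.L * B₀ * c ≤ CP * L₀ * B₀ * c := by gcongr
          have h2 : ϱ * (BD + CP * g.L * B₀ * c) ≤ ϱ * (BD + CP * L₀ * B₀ * c) :=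
            mul_le_mul_of_nonneg_left (by linarith) hϱ
          exact mul_le_mul h2 hL₀ hL0 (mul_nonneg hϱ (add_nonneg hBD (mul_nonneg (mul_nonneg (mul_nonneg hCP (hL0.trans hL₀)) hB₀) hc)))
      _ = ϱ * L₀ * (BD + CP * L₀ * B₀ * c) := by ring
      _ ≤ B₄ := hB₄
  have hB₄0 : 0 ≤ B₄ := (mul_nonneg hC0 hL0).trans hK
  have hr : Real.exp (-((ρ - α * δ) * g.dist y y')) ≤ Real.exp (-(δ₄ * g.dist y y')) :=
    Real.exp_le_exp.mpr (neg_le_neg (mul_le_mul_of_nonneg_right (by rw [hρdef]; linarith) (hG.dnn y y')))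
  exact mul_le_mul (mul_le_mul_of_nonneg_right hK hW) hr (Real.exp_nonneg _) (mul_nonneg hB₄0 hW)

/-- ★★ **THE ORDER-ZERO LETTER G₁D R D\* OF THE RE-CUT L² SCHEMA (`Letters313L2Pc.vGDRD`) IS D G′R D\* BY (3.152)** — PROVED: from `Ids3152.dr`
(G₁DR = DG′R), R = ϱ•(I − P) and the same letters as `vDRDG_of_ids3152`: G₁D R D\* = ϱ(DG′D\* − (DG′)(PD\*)) has the prefactor-free block bound
ϱ(B_D + C_P·L·B₀·c)·e^{−(δ−σ−αδ)d}, whence ‖1_{Δ(y)}G₁D R D\*f‖₂ ≦ B₄·(Lʲη∕L^{j′}η)·e^{−δ₄d(y,y′)}‖f‖₂ for any B₄ ≧ ϱ·L₀·(B_D + C_P·L₀·B₀·c),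
δ₄ ≦ δ − σ − 2αδ.  Nothing of print asserted.
[cite: Balaban1985BackgroundPropagators, (3.152)–(3.153) p.426 + Thm 3.1 (3.42)+(3.46) pp.397–398 + (3.49) p.399 + p.391 + Thm 3.13 p.426; Balaban1984PropagatorsII, (2.52)–(2.56) pp.232–233 + Lemma 2.1 (2.60)–(2.61) p.234] -/
theorem vGDRD_of_ids3152 (hG : GeoOK g) {dF : ℕ} {δ α L₀ σ c : ℝ} (hF : Facts347 g R₀ H₀ dF δ α L₀)
    (hrow : RowSum (toB6 g R₀ H₀) σ c) {𝔬 : Ops g B X Y Z W} {Gp P : B.Cfg → Module.End ℝ (W → ℝ)} {U : B.Cfg}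
    {B₀ δ₀ CP δP BD δD ϱ B₄ δ₄ : ℝ}
    (h31 : Thm31GpMaj 𝔬.blkW 𝔬.blk (Gp U) (𝔬.Dv U) (𝔬.Dvstar U) R₀ H₀ B₀ δ₀)
    (h49 : Proj349Maj 𝔬.blkW 𝔬.blk (P U) (𝔬.Dv U) (𝔬.Dvstar U) R₀ H₀ CP δP)
    (hDGD : BlockBd (g := toB6 g R₀ H₀) 𝔬.blk 𝔬.blk (𝔬.Dv U ∘ₗ Gp U ∘ₗ 𝔬.Dvstar U)
      (fun (y y' : g.Site) => BD * Real.exp (-(δD * g.dist y y'))))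
    (hR : 𝔬.R U = ϱ • (LinearMap.id - P U)) (h152 : Ids3152 𝔬 Gp U)
    (hGpT : IsTransposePair (Gp U) (Gp U)) (hDvT : IsTransposePair (𝔬.Dv U) (𝔬.Dvstar U)) (hPT : IsTransposePair (P U) (P U))
    (hϱ : 0 ≤ ϱ) (hB₀ : 0 ≤ B₀) (hCP : 0 ≤ CP) (hBD : 0 ≤ BD) (hc : 0 ≤ c) (hσ : 0 ≤ σ) (hαδ : 0 ≤ α * δ) (hδ₀ : δ ≤ δ₀)
    (hδP : δ ≤ δP)
    (hbud : 0 ≤ δ - σ - α * δ) (hδD : δ - σ - α * δ ≤ δD)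
    (hB₄ : ϱ * L₀ * (BD + CP * L₀ * B₀ * c) ≤ B₄) (hδ₄ : δ₄ ≤ δ - σ - 2 * (α * δ)) :
    BlockBd (g := toB6 g R₀ H₀) 𝔬.blk 𝔬.blk (𝔬.G1 U ∘ₗ 𝔬.Dv U ∘ₗ 𝔬.R U ∘ₗ 𝔬.Dvstar U)
      (fun (y y' : g.Site) => B₄ * (g.len y * (g.len y')⁻¹) * Real.exp (-(δ₄ * g.dist y y'))) := by
  have hL0 : 0 ≤ g.L := zero_le_one.trans hF.one_le_L
  have hL₀ : g.L ≤ L₀ := hF.L_le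
  set ρ : ℝ := δ - σ - α * δ with hρdef
  have hρ : 0 ≤ ρ := hbud
  have hρδ : ρ + σ + α * δ ≤ δ := by rw [hρdef]; linarith
  have hT₂ := blockBd_DvGpPDvs hG hF hrow h31 h49 hGpT hDvT hPT hB₀ hCP hc hσ hαδ hδ₀ hδP hρ hρδ
  have hT₁ : BlockBd (g := toB6 g R₀ H₀) 𝔬.blk 𝔬.blk (𝔬.Dv U ∘ₗ Gp U ∘ₗ 𝔬.Dvstar U)
      (fun (y y' : g.Site) => BD * Real.exp (-(ρ * g.dist y y'))) :=
    hDGD.mono fun y y' => mul_le_mul_of_nonneg_left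
      (Real.exp_le_exp.mpr (neg_le_neg (mul_le_mul_of_nonneg_right hδD (hG.dnn y y')))) hBD
  -- G₁D R D* = ϱ(DG′D* − (DG′)(PD*)) pointwise, by (3.152) and R = ϱ(I − P)
  have hid : ∀ f, (𝔬.G1 U ∘ₗ 𝔬.Dv U ∘ₗ 𝔬.R U ∘ₗ 𝔬.Dvstar U) f =
      ϱ • ((𝔬.Dv U ∘ₗ Gp U ∘ₗ 𝔬.Dvstar U) f - ((𝔬.Dv U ∘ₗ Gp U) ∘ₗ (P U ∘ₗ 𝔬.Dvstar U)) f) := fun f => by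
    simp only [LinearMap.comp_apply]
    rw [h152.dr_apply, hR]
    simp only [LinearMap.smul_apply, LinearMap.sub_apply, LinearMap.id_apply, map_smul, map_sub]
  have hflat := blockBd_smul_sub hϱ hT₁ hT₂ hid
  have hC0 : 0 ≤ ϱ * (BD + CP * g.L * B₀ * c) :=
    mul_nonneg hϱ (add_nonneg hBD (mul_nonneg (mul_nonneg (mul_nonneg hCP hL0) hB₀) hc))
  have h := (blockBd_ratio_of_flat hG hF hC0 hflat).2
  refine h.mono fun y y' => ?_
  have hW : 0 ≤ g.len y * (g.len y')⁻¹ := mul_nonneg (hG.lenle y) (inv_nonneg.mpr (hG.lenle y'))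
  have hK : ϱ * (BD + CP * g.L * B₀ * c) * g.L ≤ B₄ := by
    calc ϱ * (BD + CP * g.L * B₀ * c) * g.L ≤ ϱ * (BD + CP * L₀ * B₀ * c) * L₀ := by
          have h1 : CP * g.L * B₀ * c ≤ CP * L₀ * B₀ * c := by gcongr
          have h2 : ϱ * (BD + CP * g.L * B₀ * c) ≤ ϱ * (BD + CP * L₀ * B₀ * c) :=
            mul_le_mul_of_nonneg_left (by linarith) hϱ
          exact mul_le_mul h2 hL₀ hL0 (mul_nonneg hϱ (add_nonneg hBD (mul_nonneg (mul_nonneg (mul_nonneg hCP (hL0.trans hL₀)) hB₀) hc)))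
      _ = ϱ * L₀ * (BD + CP * L₀ * B₀ * c) := by ring
      _ ≤ B₄ := hB₄
  have hB₄0 : 0 ≤ B₄ := (mul_nonneg hC0 hL0).trans hK
  have hr : Real.exp (-((ρ - α * δ) * g.dist y y')) ≤ Real.exp (-(δ₄ * g.dist y y')) :=
    Real.exp_le_exp.mpr (neg_le_neg (mul_le_mul_of_nonneg_right (by rw [hρdef]; linarith) (hG.dnn y y')))
  exact mul_le_mul (mul_le_mul_of_nonneg_right hK hW) hr (Real.exp_nonneg _) (mul_nonneg hB₄0 hW)

end

end Literature.MathematicalPhysics.QuantumFieldTheory.Balaban1983to89.B9Thm313WholeCutLettersL2From3152
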